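import Mathlib
import Literature.MathematicalPhysics.QuantumFieldTheory.Balaban1983to89.B6QGQSymbol275Zd

/-!
# [B5] (1.67) p.29 — the UPPER constant of the scalar inequality (1.67) on `ℤ^d`, SHARPENED through the
# printed multiplier (2.75) of [B6]: `γ₁♯(d) = (π²/4)^{d+1}` in place of `γ₁(d) = 2 + 8d²·36^d`

[B5] = T. Bałaban, *Propagators and renormalization transformations for lattice gauge theories. I*, Commun.
Math. Phys. **95** (1984) 17–40 [`Balaban1984PropagatorsI`], (1.66)–(1.67) p.29: `γ₀⟨∂B, ∂B⟩ ≤ ⟨B, Δ_k B⟩ ≤ γ₁⟨∂B, ∂B⟩` with `γ₀, γ₁` depending on `d` only; and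
[B6] = *Propagators and renormalization transformations for lattice gauge theories. II*, Commun. Math. Phys.
**96** (1984) 223–250 [`Balaban1984PropagatorsII`], (2.75)–(2.76) p.236 (the multiplier of `Q′G′Q′*`).  SCALAR SHADOW (`U = 1`), unit fine lattice,
`m² = 0`, dummy mass `a > 0`, whole lattice `ℤ^d`, exactly as the pv23 column (nodes 5, 8, 9, 11, g8-1, g8-2,
g9-1, g9-2, g9-3).

WHAT THIS LEAF ADDS.  The tree proves (1.67) in the scalar whole-lattice setting with the explicit constants
`γ₀ = 1` (node 9, `B5Ineq167LowerZd.ineq167_lower_scalar`, block-averaging contraction) and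
`γ₁(d) = B5Ineq167UpperZd.gamma1 d = 2 + 8d²·36^d` (node g8-1, `ineq167_upper_scalar`, an explicit test
configuration), transported to the multiplier as `B5Ineq167SymbolZd.sigma_bounds : ω ≤ σ_{n,a} ≤ γ₁(d)·ω`.
Here the upper constant is re-derived through the CLOSED FORM of the multiplier landed in node g9-3
(`B6QGQSymbol275Zd.sigma_eq_closed`: `σ_{n,a}(p′) = Δ^ξ(p′)/X(p′)` on the zone, `X = Σ_k U_k R_k` the [B6] (2.75)
regrouping, `Δ^ξ = B4Strip.DeltaXir (n+1) 0` the blocked Laplacian symbol) together with two elementary bounds: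
`X(p′) ≥ U₀(p′) ≥ (4/π²)^d` ([B6] (2.50), node g9-2 `B6QGQFourier275Zd.Xr_ge`) and the Jordan bound
`Δ^ξ(p′) = Σ_μ (n+1)²(2 − 2cos(p′_μ/(n+1))) ≤ Σ_μ p′_μ² ≤ (π²/4)·Σ_μ (2 − 2cos p′_μ) = (π²/4)·ω(p′)` on `[-π, π]^d`
(`B4Strip.Sxir_le`, `B4Strip.S1r_ge`).  Result:

* §2 **`sigma_le_sharp`: `σ_{n,a}(p′) ≤ (π²/4)^{d+1}·ω(p′)` for `p′ ∈ [-π, π]^d`**, every `n`, every `a > 0`;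
  `sigma_bounds_sharp` (with the lower constant `1`); and by `2π`-periodicity of `σ` and `ω` in each coordinate
  (`sigma_add_two_pi`, `omega_add_two_pi`, reduction `exists_mem_BZ_add_two_pi` via `toIocMod`)
  **`sigma_bounds_sharp'`: the same for EVERY `p ∈ ℝ^d`** — the statement of `sigma_bounds` with `gamma1 d`
  replaced by `gamma1Sharp d = (π²/4)^{d+1}`;
* §3 **`ineq167_upper_sharp` / `ineq167_scalar_sharp`: `⟨∂₁B, ∂₁B⟩ ≤ ⟨B, Δ^{scalar}_{n,a}B⟩ ≤ (π²/4)^{d+1}·⟨∂₁B, ∂₁B⟩`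
  for every finitely supported coarse field `B : ℤ^d → ℝ`**, every `n`, every `a > 0` — node g9-1's Parseval
  transfer `B5Momentum166Zd.form_bounds_of_symbol_bounds` applied to the sharpened symbol bounds;
* §4 **`gamma1Sharp_lt_gamma1`: `(π²/4)^{d+1} < 2 + 8d²·36^d` for `d ≥ 1`** (kernel numerics from
  `Real.pi_lt_d2 : π < 3.15`; at `d = 0` the comparison fails, `π²/4 > 2`), and the crude improvement factor
  `gamma1Sharp_mul_lt_gamma1 : γ₁♯(d)·14^d < γ₁(d)`.  Numerically at `d = 4`: `γ₁♯(4) = (π²/4)⁵ ≈ 91.5` against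
  `γ₁(4) = 2 + 128·36⁴ ≈ 2.15·10⁸`;
* §5 the INVERSE multiplier: **`symbR_eq_inv`: `(Q′G′Q′*)^(p′) = 1/(a + σ_{n,a}(p′))`**, **`hasSum_Kinv_cos`:
  `Σ_{x ∈ ℤ^d} (Q′G′Q′*)⁻¹(x, 0)·cos(p′·x) = 1/(Q′G′Q′*)^(p′)`** (the symbol of node 5's `Kinv`, [B5] (1.58) scalar
  shadow), and the printed multiplier PINNED between explicit rational functions of `ω`:
  **`1/(a + (π²/4)^{d+1}ω(p′)) ≤ (Q′G′Q′*)^(p′) ≤ 1/(a + ω(p′))`** (`inv_omega_le_symbR`, `symbR_le_inv_omega`),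
  with the consistency identity `twoGamma0_eq_inv : 2γ₀(d, a) = 1/(a + 4d·γ₁♯(d))` — node g9-2's (2.76) constant
  is exactly the lower pinching evaluated at `ω ≤ 4d` (`twoGamma0_le_inv_omega`).

DICTIONARY (as the column).  `p′ ∈ [-π, π]^d = B4ContourShift.BZ d` the coarse Brillouin zone; `σ = sigma n a`
(node g8-2) the symbol of the coarse scalar action `Δ^{scalar}_{n,a} = (Q′G′Q′*)⁻¹ − a` (node 8 `actionKer`, node 5
`Kinv`); `ω(p) = Σ_μ (2 − 2cos p_μ)` the symbol of `⟨∂₁B, ∂₁B⟩ = B5Hk103Minimizer.energy`;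
`⟨B, Δ^{scalar}B⟩ = B5Hk165ActionZd.actionForm`; `(Q′G′Q′*)^ = B6QGQFourier275Zd.symbR (n+1) a` the printed
multiplier (2.75) on real momenta; `Δ^ξ(p′) = DeltaXir (n+1) 0 p′` (print's `Δ(p′)`-type blocked symbol; the
normaliser of (2.75), written `Δ₀(p′)` in node g9-2's prose, is [B4]'s unit-lattice symbol and cancels — wording
note D1 of the node g9-2 cross-read, immaterial here).

HONEST SCOPE.  (i) Scalar `U = 1`, unit fine lattice, `m² = 0`, whole lattice `ℤ^d`, finitely supported `B` —
NOT the covariant / small-field statement of [B5] (1.67), NOT the torus.  (ii) `(π²/4)^{d+1}` is an explicit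
admissible constant obtained from `X ≥ U₀` alone; it is NOT claimed optimal (the supremum of `σ/ω` is not computed
here).  (iii) The lower constant `γ₀ = 1` is node 9's, unchanged.  (iv) Nothing printed is a hypothesis: every
statement is a closed theorem over the tree's definitions; in particular §3 does not use node g8-1's test-field
construction at all (only node 9 for the lower side).  Value = kernel discharge (a sharper explicit constant in a
landed inequality, and the (1.58)/(2.75) inverse-multiplier identities), NOT summit progress.
-/

namespace Literature.MathematicalPhysics.QuantumFieldTheory.Balaban1983to89.B5Ineq167SharpUpperZd

open Finset
open B6QGQLower276 (X)
open B4ContourShift (BZ)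
open B4Strip (S1r Sxir DeltaXir S1r_ge Sxir_le DeltaXir_nonneg)
open B5Ineq167SymbolZd (sigma omega sigma_bounds omega_le phase kappa)
open B5Ineq167UpperZd (gamma1)
open B5Hk103Minimizer (energy)
open B5Hk165ActionZd (actionForm)
open B5Ineq167LowerZd (ineq167_lower_scalar)
open B5Momentum166Zd (form_bounds_of_symbol_bounds)
open B5Hk103ScalarZd (Kinv)
open B5Hk165ActionZd (actionKer)
open B5Ineq167SymbolZd (sigma_nonneg phase_zero summable_abs_kappa)
open B6QGQFourier275Zd (Xr Xr_ge DeltaXir_zero_le symbR twoGamma0 twoGamma0_pos symbR_ge)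
open B6QGQSymbol275Zd (sigma_eq_closed sigma_eq_inv_symbR_sub summable_kappa_mul)
open scoped Real

noncomputable section

variable {d : ℕ}

/-! ## §1  The sharpened constant and the one-dimensional Jordan bound -/

/-- **the sharpened upper constant `γ₁♯(d) = (π²/4)^{d+1}`** of (1.67) in the scalar whole-lattice setting
(d = 4: `≈ 91.5`). [cite: Balaban1984PropagatorsI, (1.67) p.29] -/
def gamma1Sharp (d : ℕ) : ℝ := (π ^ 2 / 4) ^ (d + 1)

/-- `γ₁♯ > 0`. [folklore] -/
theorem gamma1Sharp_pos (d : ℕ) : 0 < gamma1Sharp d := by unfold gamma1Sharp; positivity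

/-- Jordan's inequality in the form `x² ≤ (π²/4)·(2 − 2cos x)` for `|x| ≤ π`. [folklore] -/
theorem sq_le_S1r (x : ℝ) (hx : |x| ≤ π) : x ^ 2 ≤ π ^ 2 / 4 * S1r x := by
  have h := S1r_ge x hx
  have hπ : (0 : ℝ) < π ^ 2 := by positivity
  rw [div_le_iff₀ hπ] at h
  nlinarith

/-- `S_ξ(x) = n²(2 − 2cos(x/n)) ≤ x² ≤ (π²/4)(2 − 2cos x)` on `|x| ≤ π`: the blocked one-dimensional symbol is
dominated by the unit-lattice one up to `π²/4`. [folklore] -/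
theorem Sxir_le_S1r (N : ℕ) (x : ℝ) (hx : |x| ≤ π) : Sxir N x ≤ π ^ 2 / 4 * S1r x :=
  (Sxir_le N x).trans (sq_le_S1r x hx)

/-- `ω(p) = Σ_μ (2 − 2cos p_μ) = Σ_μ S₁(p_μ)`. [folklore] -/
theorem omega_eq_sum_S1r (p : Fin d → ℝ) : omega p = ∑ μ, S1r (p μ) := by
  unfold omega S1r; rfl

/-- **`Δ^ξ(p′) ≤ (π²/4)·ω(p′)` on the zone** (`m² = 0`). [folklore] -/
theorem DeltaXir_zero_le_omega (N : ℕ) (p : Fin d → ℝ) (hp : ∀ μ, |p μ| ≤ π) :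
    DeltaXir N 0 p ≤ π ^ 2 / 4 * omega p := by
  unfold DeltaXir
  rw [add_zero, omega_eq_sum_S1r, Finset.mul_sum]
  exact Finset.sum_le_sum fun μ _ => Sxir_le_S1r N (p μ) (hp μ)

/-- `(4/π²)^d = ((π²/4)^d)⁻¹`. [folklore] -/
theorem four_div_pi_sq_pow (d : ℕ) : ((4 : ℝ) / π ^ 2) ^ d = ((π ^ 2 / 4) ^ d)⁻¹ := by
  rw [← inv_pow, inv_div]

/-! ## §2  The symbol bound `σ ≤ γ₁♯ ω` on the zone, and on all of `ℝ^d` by periodicity -/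

/-- membership in the zone as coordinate bounds. [folklore] -/
theorem abs_le_pi_of_mem_BZ {p : Fin d → ℝ} (hp : p ∈ BZ d) (μ : Fin d) : |p μ| ≤ π :=
  abs_le.2 ⟨hp.1 μ, hp.2 μ⟩

/-- **`σ_{n,a}(p′) ≤ (π²/4)^{d+1}·ω(p′)` for `p′ ∈ [-π, π]^d`**: closed form `σ = Δ^ξ/X` (node g9-3
`sigma_eq_closed`), `X ≥ (4/π²)^d` ((2.50), node g9-2 `Xr_ge`) and `Δ^ξ ≤ (π²/4)ω`.
[cite: Balaban1984PropagatorsI, (1.66)-(1.67) p.29] -/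
theorem sigma_le_sharp (n : ℕ) {a : ℝ} (ha : 0 < a) {p : Fin d → ℝ} (hp : p ∈ BZ d) :
    sigma n a p ≤ gamma1Sharp d * omega p := by
  have hπ : ∀ μ, |p μ| ≤ π := abs_le_pi_of_mem_BZ hp
  have hc : (0 : ℝ) < (4 / π ^ 2) ^ d := by positivity
  have hX : (4 / π ^ 2) ^ d ≤ Xr (n + 1) p := Xr_ge (n + 1) (by omega) p hπ
  have hD : 0 ≤ DeltaXir (n + 1) 0 p := DeltaXir_nonneg (n + 1) 0 le_rfl p
  rw [sigma_eq_closed n ha hp]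
  calc DeltaXir (n + 1) 0 p / Xr (n + 1) p ≤ DeltaXir (n + 1) 0 p / (4 / π ^ 2) ^ d :=
        div_le_div_of_nonneg_left hD hc hX
    _ = (π ^ 2 / 4) ^ d * DeltaXir (n + 1) 0 p := by
        rw [four_div_pi_sq_pow, div_inv_eq_mul, mul_comm]
    _ ≤ (π ^ 2 / 4) ^ d * (π ^ 2 / 4 * omega p) :=
        mul_le_mul_of_nonneg_left (DeltaXir_zero_le_omega _ p hπ) (by positivity)
    _ = gamma1Sharp d * omega p := by unfold gamma1Sharp; ring

/-- **the two-sided multiplier bounds with the sharpened upper constant, on the zone**: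
`ω(p′) ≤ σ_{n,a}(p′) ≤ (π²/4)^{d+1} ω(p′)` (lower constant `γ₀ = 1` from node 9 / g8-2 `sigma_bounds`).
[cite: Balaban1984PropagatorsI, (1.66)-(1.67) p.29] -/
theorem sigma_bounds_sharp (n : ℕ) {a : ℝ} (ha : 0 < a) {p : Fin d → ℝ} (hp : p ∈ BZ d) :
    omega p ≤ sigma n a p ∧ sigma n a p ≤ gamma1Sharp d * omega p :=
  ⟨(sigma_bounds n ha p).1, sigma_le_sharp n ha hp⟩

/-- a `p`-independent bound on the zone: `σ ≤ (π²/4)^d · dπ²` (from `Δ^ξ ≤ dπ²`). [folklore] -/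
theorem sigma_le_sup_sharp (n : ℕ) {a : ℝ} (ha : 0 < a) {p : Fin d → ℝ} (hp : p ∈ BZ d) :
    sigma n a p ≤ (π ^ 2 / 4) ^ d * (d * π ^ 2) := by
  have hπ : ∀ μ, |p μ| ≤ π := abs_le_pi_of_mem_BZ hp
  have hc : (0 : ℝ) < (4 / π ^ 2) ^ d := by positivity
  have hX : (4 / π ^ 2) ^ d ≤ Xr (n + 1) p := Xr_ge (n + 1) (by omega) p hπ
  have hD : 0 ≤ DeltaXir (n + 1) 0 p := DeltaXir_nonneg (n + 1) 0 le_rfl p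
  rw [sigma_eq_closed n ha hp]
  calc DeltaXir (n + 1) 0 p / Xr (n + 1) p ≤ DeltaXir (n + 1) 0 p / (4 / π ^ 2) ^ d :=
        div_le_div_of_nonneg_left hD hc hX
    _ = (π ^ 2 / 4) ^ d * DeltaXir (n + 1) 0 p := by
        rw [four_div_pi_sq_pow, div_inv_eq_mul, mul_comm]
    _ ≤ (π ^ 2 / 4) ^ d * (d * π ^ 2) :=
        mul_le_mul_of_nonneg_left (DeltaXir_zero_le (n + 1) p hπ) (by positivity)

/-! ### periodicity: the bound on all of `ℝ^d` -/

/-- `σ_{n,a}` is `2π`-periodic in each coordinate: `σ(p + 2πk) = σ(p)` for `k ∈ ℤ^d`. [folklore] -/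
theorem sigma_add_two_pi (n : ℕ) (a : ℝ) (p : Fin d → ℝ) (k : Fin d → ℤ) :
    sigma n a (fun μ => p μ + 2 * π * k μ) = sigma n a p := by
  unfold sigma
  congr 1; funext z
  congr 1
  have : phase (fun μ => p μ + 2 * π * k μ) z = phase p z + ((∑ μ, k μ * z μ : ℤ) : ℝ) * (2 * π) := by
    unfold phase; push_cast
    rw [Finset.sum_mul, ← Finset.sum_add_distrib]
    exact Finset.sum_congr rfl fun μ _ => by ring
  rw [this, Real.cos_add_int_mul_two_pi]

/-- `ω` is `2π`-periodic in each coordinate. [folklore] -/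
theorem omega_add_two_pi (p : Fin d → ℝ) (k : Fin d → ℤ) :
    omega (fun μ => p μ + 2 * π * k μ) = omega p := by
  unfold omega
  exact Finset.sum_congr rfl fun μ _ => by
    show 2 - 2 * Real.cos (p μ + 2 * π * k μ) = 2 - 2 * Real.cos (p μ)
    rw [show p μ + 2 * π * k μ = p μ + (k μ : ℝ) * (2 * π) by ring, Real.cos_add_int_mul_two_pi]

/-- reduction of a momentum to the zone modulo `2πℤ^d`. [folklore] -/
theorem exists_mem_BZ_add_two_pi (p : Fin d → ℝ) :
    ∃ (p' : Fin d → ℝ) (k : Fin d → ℤ), p' ∈ BZ d ∧ p = fun μ => p' μ + 2 * π * k μ := by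
  refine ⟨fun μ => toIocMod Real.two_pi_pos (-π) (p μ), fun μ => toIocDiv Real.two_pi_pos (-π) (p μ),
    Set.mem_Icc.2 ⟨fun μ => ?_, fun μ => ?_⟩, ?_⟩
  · exact (toIocMod_mem_Ioc Real.two_pi_pos (-π) (p μ)).1.le
  · have h := (toIocMod_mem_Ioc Real.two_pi_pos (-π) (p μ)).2
    linarith
  · funext μ
    have h := toIocMod_add_toIocDiv_zsmul Real.two_pi_pos (-π) (p μ)
    rw [zsmul_eq_mul] at h
    linarith

/-- **`σ_{n,a}(p) ≤ (π²/4)^{d+1}·ω(p)` for EVERY `p ∈ ℝ^d`** (periodicity), i.e. the tree's `sigma_bounds`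
with `gamma1 d = 2 + 8d²·36^d` replaced by `(π²/4)^{d+1}`. [cite: Balaban1984PropagatorsI, (1.66)-(1.67) p.29] -/
theorem sigma_bounds_sharp' (n : ℕ) {a : ℝ} (ha : 0 < a) (p : Fin d → ℝ) :
    omega p ≤ sigma n a p ∧ sigma n a p ≤ gamma1Sharp d * omega p := by
  refine ⟨(sigma_bounds n ha p).1, ?_⟩
  obtain ⟨p', k, hp', rfl⟩ := exists_mem_BZ_add_two_pi p
  rw [sigma_add_two_pi, omega_add_two_pi]
  exact sigma_le_sharp n ha hp'

/-! ## §3  The FORM inequality (1.67) with the sharpened upper constant -/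

/-- **(1.67), scalar, whole lattice, SHARPENED UPPER CONSTANT: `⟨B, Δ^{scalar}_{n,a} B⟩ ≤ (π²/4)^{d+1}·⟨∂₁B, ∂₁B⟩`**
for every finitely supported coarse field `B`, every `n`, every `a > 0` (node g9-1's Parseval transfer
`form_bounds_of_symbol_bounds` applied to `sigma_bounds_sharp`). [cite: Balaban1984PropagatorsI, (1.67) p.29] -/
theorem ineq167_upper_sharp (n : ℕ) {a : ℝ} (ha : 0 < a) (T : Finset (X d)) (Bf : X d → ℝ)
    (hT : ∀ y ∉ T, Bf y = 0) : actionForm n a T Bf ≤ gamma1Sharp d * energy Bf :=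
  (form_bounds_of_symbol_bounds n ha (γ₀ := 1) (γ₁ := gamma1Sharp d)
    (fun p hp => ⟨by rw [one_mul]; exact (sigma_bounds n ha p).1, sigma_le_sharp n ha hp⟩) Bf hT).2

/-- **(1.67), scalar, whole lattice, both sides with explicit constants `γ₀ = 1`, `γ₁♯ = (π²/4)^{d+1}`.**
[cite: Balaban1984PropagatorsI, (1.67) p.29] -/
theorem ineq167_scalar_sharp (n : ℕ) {a : ℝ} (ha : 0 < a) (T : Finset (X d)) (Bf : X d → ℝ)
    (hT : ∀ y ∉ T, Bf y = 0) :
    energy Bf ≤ actionForm n a T Bf ∧ actionForm n a T Bf ≤ gamma1Sharp d * energy Bf :=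
  ⟨ineq167_lower_scalar n ha T Bf hT, ineq167_upper_sharp n ha T Bf hT⟩

/-! ## §4  Comparison with the tree's constant `γ₁(d) = 2 + 8d²·36^d` -/

/-- `π²/4 < 5/2`. [folklore] -/
theorem pi_sq_div_four_lt : π ^ 2 / 4 < 5 / 2 := by
  have h1 := Real.pi_lt_d2
  have h2 := Real.pi_pos
  nlinarith

/-- **`γ₁♯(d) < γ₁(d)` for every `d ≥ 1`**: `(π²/4)^{d+1} < (5/2)^{d+1} ≤ 8d²·36^d < 2 + 8d²·36^d`.
(At `d = 0` it fails: `π²/4 > 2 = γ₁(0)`.) [folklore] -/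
theorem gamma1Sharp_lt_gamma1 (hd : 1 ≤ d) : gamma1Sharp d < gamma1 d := by
  have h1 : gamma1Sharp d < (5 / 2 : ℝ) ^ (d + 1) :=
    pow_lt_pow_left₀ pi_sq_div_four_lt (by positivity) (by omega)
  have hd' : (1 : ℝ) ≤ d := by exact_mod_cast hd
  have h2 : (5 / 2 : ℝ) ^ (d + 1) ≤ 8 * (d : ℝ) ^ 2 * 36 ^ d := by
    rw [pow_succ]
    calc (5 / 2 : ℝ) ^ d * (5 / 2) ≤ 36 ^ d * (8 * (d : ℝ) ^ 2) :=
          mul_le_mul (pow_le_pow_left₀ (by norm_num) (by norm_num) d) (by nlinarith) (by norm_num)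
            (by positivity)
      _ = 8 * (d : ℝ) ^ 2 * 36 ^ d := by ring
  unfold gamma1
  linarith

/-- the improvement factor is at least `36^d·8d²/(5/2)^{d+1}`; e.g. **`γ₁♯(d) · (5/2)^0 ≤ …`**: a crude but
kernel-checked statement `γ₁♯(d) · 14^d < γ₁(d)` for `d ≥ 1` (since `(5/2)·14 = 35 < 36`). [folklore] -/
theorem gamma1Sharp_mul_lt_gamma1 (hd : 1 ≤ d) : gamma1Sharp d * 14 ^ d < gamma1 d := by
  have h1 : gamma1Sharp d < (5 / 2 : ℝ) ^ (d + 1) :=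
    pow_lt_pow_left₀ pi_sq_div_four_lt (by positivity) (by omega)
  have hd' : (1 : ℝ) ≤ d := by exact_mod_cast hd
  have h14 : (0 : ℝ) < 14 ^ d := by positivity
  have h2 : (5 / 2 : ℝ) ^ (d + 1) * 14 ^ d ≤ 8 * (d : ℝ) ^ 2 * 36 ^ d := by
    rw [pow_succ, mul_assoc, mul_comm (5 / 2 : ℝ) _, ← mul_assoc, ← mul_pow]
    calc (5 / 2 * 14 : ℝ) ^ d * (5 / 2) ≤ 36 ^ d * (8 * (d : ℝ) ^ 2) :=
          mul_le_mul (pow_le_pow_left₀ (by norm_num) (by norm_num) d) (by nlinarith) (by norm_num)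
            (by positivity)
      _ = 8 * (d : ℝ) ^ 2 * 36 ^ d := by ring
  have h3 : gamma1Sharp d * 14 ^ d < (5 / 2 : ℝ) ^ (d + 1) * 14 ^ d := mul_lt_mul_of_pos_right h1 h14
  unfold gamma1
  linarith

/-! ## §5  The inverse multiplier `1/(Q′G′Q′*)^ = a + σ` as the symbol of `(Q′G′Q′*)⁻¹`, and the printed
multiplier (2.75) pinned between explicit rational functions of `ω` -/

/-- `a + ω(p) > 0` for `a > 0` (as `ω ≥ 0`). [folklore] -/
theorem add_omega_pos {a : ℝ} (ha : 0 < a) (p : Fin d → ℝ) : 0 < a + omega p := by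
  have h0 : 0 ≤ omega p := by
    unfold omega
    exact Finset.sum_nonneg fun μ _ => by linarith [Real.cos_le_one (p μ)]
  linarith

/-- **`(Q′G′Q′*)^(p′) = 1/(a + σ_{n,a}(p′))` on the zone** (node g9-3's `σ = 1/(Q′G′Q′*)^ − a`, inverted).
[cite: Balaban1984PropagatorsII, (2.75) p.236] -/
theorem symbR_eq_inv (n : ℕ) {a : ℝ} (ha : 0 < a) {p : Fin d → ℝ} (hp : p ∈ BZ d) :
    symbR (n + 1) a p = 1 / (a + sigma n a p) := by
  have hs : a + sigma n a p = 1 / symbR (n + 1) a p := by rw [sigma_eq_inv_symbR_sub n ha hp]; ring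
  rw [hs, one_div_one_div]

/-- **the symbol of `(Q′G′Q′*)⁻¹`: `Σ_{x ∈ ℤ^d} (Q′G′Q′*)⁻¹(x, 0)·cos(p′·x) = 1/(Q′G′Q′*)^(p′)` on the zone**
(`(Q′G′Q′*)⁻¹ = Δ^{scalar} + aδ` of node 8, the `κ`-series `σ` of node g8-2, and `σ + a = 1/(Q′G′Q′*)^`).
[cite: Balaban1984PropagatorsI, (1.58) p.27] -/
theorem hasSum_Kinv_cos (n : ℕ) {a : ℝ} (ha : 0 < a) {p : Fin d → ℝ} (hp : p ∈ BZ d) :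
    HasSum (fun x : X d => Kinv n a x 0 * Real.cos (phase p x)) (1 / symbR (n + 1) a p) := by
  have h1 : HasSum (fun z : X d => kappa n a z * Real.cos (phase p z)) (sigma n a p) := by
    unfold sigma
    exact (summable_kappa_mul ha (g := fun z => Real.cos (phase p z)) (C := 1)
      (fun w => Real.abs_cos_le_one _)).hasSum
  have h2 : HasSum (fun z : X d => a * (if z = 0 then (1 : ℝ) else 0) * Real.cos (phase p z)) a := by
    have : (fun z : X d => a * (if z = 0 then (1 : ℝ) else 0) * Real.cos (phase p z)) =
        fun z => if z = 0 then a else 0 := by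
      funext z
      split_ifs with h
      · subst h; rw [phase_zero, Real.cos_zero]; ring
      · ring
    rw [this]
    exact hasSum_ite_eq 0 a
  have hk : ∀ z : X d, Kinv n a z 0 * Real.cos (phase p z) =
      kappa n a z * Real.cos (phase p z) + a * (if z = 0 then (1 : ℝ) else 0) * Real.cos (phase p z) := by
    intro z; unfold kappa actionKer; ring
  simp_rw [hk]
  have h := h1.add h2
  rwa [sigma_eq_inv_symbR_sub n ha hp, sub_add_cancel] at h

/-- `Σ'` form of `hasSum_Kinv_cos`. [cite: Balaban1984PropagatorsI, (1.58) p.27] -/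
theorem tsum_Kinv_cos (n : ℕ) {a : ℝ} (ha : 0 < a) {p : Fin d → ℝ} (hp : p ∈ BZ d) :
    ∑' x : X d, Kinv n a x 0 * Real.cos (phase p x) = 1 / symbR (n + 1) a p :=
  (hasSum_Kinv_cos n ha hp).tsum_eq

/-- **upper pinching of the printed multiplier by `ω`: `(Q′G′Q′*)^(p′) ≤ 1/(a + ω(p′))` on the zone**
(from `σ ≥ ω`, node 9). [cite: Balaban1984PropagatorsII, (2.75)-(2.76) p.236] -/
theorem symbR_le_inv_omega (n : ℕ) {a : ℝ} (ha : 0 < a) {p : Fin d → ℝ} (hp : p ∈ BZ d) :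
    symbR (n + 1) a p ≤ 1 / (a + omega p) := by
  rw [symbR_eq_inv n ha hp]
  exact one_div_le_one_div_of_le (add_omega_pos ha p) (by linarith [(sigma_bounds n ha p).1])

/-- **lower pinching of the printed multiplier by `ω`: `1/(a + (π²/4)^{d+1}ω(p′)) ≤ (Q′G′Q′*)^(p′)` on the zone**
(from `σ ≤ γ₁♯ω`). [cite: Balaban1984PropagatorsII, (2.75)-(2.76) p.236] -/
theorem inv_omega_le_symbR (n : ℕ) {a : ℝ} (ha : 0 < a) {p : Fin d → ℝ} (hp : p ∈ BZ d) :
    1 / (a + gamma1Sharp d * omega p) ≤ symbR (n + 1) a p := by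
  rw [symbR_eq_inv n ha hp]
  exact one_div_le_one_div_of_le (by linarith [sigma_nonneg n ha p]) (by linarith [sigma_le_sharp n ha hp])

/-- consistency with node g9-2's (2.76) constant: **`2γ₀(d,a) = 1/(a + 4d·γ₁♯(d))`** — the lower pinching at
`ω ≤ 4d` is exactly node g9-2's `symbR_ge`. [folklore] -/
theorem twoGamma0_eq_inv (d : ℕ) (a : ℝ) (ha : 0 < a) : twoGamma0 d a = 1 / (a + 4 * d * gamma1Sharp d) := by
  have hq : (0 : ℝ) < (π ^ 2 / 4) ^ d := by positivity
  have hden : 0 < a + 4 * d * gamma1Sharp d := by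
    have := gamma1Sharp_pos d; positivity
  unfold twoGamma0
  rw [four_div_pi_sq_pow, div_eq_div_iff (by positivity) hden.ne']
  unfold gamma1Sharp
  field_simp
  ring

/-- the lower pinching implies node g9-2's zone-uniform bound: `2γ₀ ≤ 1/(a + γ₁♯ω) ≤ (Q′G′Q′*)^` (as `ω ≤ 4d`).
[cite: Balaban1984PropagatorsII, (2.76) p.236] -/
theorem twoGamma0_le_inv_omega {a : ℝ} (ha : 0 < a) (p : Fin d → ℝ) :
    twoGamma0 d a ≤ 1 / (a + gamma1Sharp d * omega p) := by
  rw [twoGamma0_eq_inv d a ha]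
  have hγ := gamma1Sharp_pos d
  have h0 : 0 ≤ omega p := by
    unfold omega
    exact Finset.sum_nonneg fun μ _ => by linarith [Real.cos_le_one (p μ)]
  exact one_div_le_one_div_of_le (by positivity) (by nlinarith [omega_le p])

end

end Literature.MathematicalPhysics.QuantumFieldTheory.Balaban1983to89.B5Ineq167SharpUpperZd
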